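import Summits.Ventures.PercRepro.S2TopFiveHit

/-!
# PercRepro — S2: THE `k`-SUBSETS MEETING THREE SETS — THE TWO INCLUSION–EXCLUSION COUNTS OF THE DISJOINT-TRIANGLES LEVER
(p7, gen 15; sub-claim S2)

For a finite `Z` and sets `Y₁ Y₂ Y₃`, with `a_S := C(|Z ∖ ⋃_{i ∈ S} Y_i|, k)`:
* **`ncard_subsets_inter_nonempty_three_add_le`** — the `k`-subsets of `Z` meeting all three:
  `#{meet all} + a₁ + a₂ + a₃ + a₁₂₃ ≤ C(|Z|, k) + a₁₂ + a₁₃ + a₂₃` (exact inclusion–exclusion on the complement families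
  `𝒫_k(Z ∖ Y_i)`; the complement map makes it also the count of the `(|Z| − k)`-subsets containing none of the `Y_i`);
* **`ncard_subsets_two_of_three_add_le`** — the `k`-subsets meeting at least two of the three:
  `#{meet ≥ 2} + a₁₂ + a₁₃ + a₂₃ ≤ C(|Z|, k) + 2·a₁₂₃` (the complement families `𝒫_k(Z ∖ (Y_i ∪ Y_j))` pairwise meet in
  `𝒫_k(Z ∖ (Y₁ ∪ Y₂ ∪ Y₃))`).
These are the counts `H₆(3)` and `H₅(3)` of S2 v44 §GAP (ac) (with `Z = E`, the `Y_i` three pairwise disjoint triangles): a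
top `6`-set is a cobasis and meets every triangle, a top `5`-set misses at most one. Nothing about any cell is claimed.
Axioms: standard.
-/

namespace PercRepro

namespace S2

open Set

variable {α : Type}

/-- The `k`-subsets of `Z ∖ Y₁` that are also `k`-subsets of `Z ∖ Y₂` are the `k`-subsets of `Z ∖ (Y₁ ∪ Y₂)`. -/
theorem subsets_sdiff_inter_eq (Z Y₁ Y₂ : Set α) (k : ℕ) :
    {X : Set α | X ⊆ Z \ Y₁ ∧ X.ncard = k} ∩ {X : Set α | X ⊆ Z \ Y₂ ∧ X.ncard = k} =
      {X : Set α | X ⊆ Z \ (Y₁ ∪ Y₂) ∧ X.ncard = k} := by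
  ext X
  simp only [Set.mem_inter_iff, Set.mem_setOf_eq]
  constructor
  · rintro ⟨⟨h1, hk⟩, ⟨h2, -⟩⟩
    refine ⟨fun y hy => ⟨(h1 hy).1, ?_⟩, hk⟩
    rintro (hy1 | hy2)
    · exact (h1 hy).2 hy1
    · exact (h2 hy).2 hy2
  · rintro ⟨h, hk⟩
    exact ⟨⟨fun y hy => ⟨(h hy).1, fun hy1 => (h hy).2 (Or.inl hy1)⟩, hk⟩,
      ⟨fun y hy => ⟨(h hy).1, fun hy2 => (h hy).2 (Or.inr hy2)⟩, hk⟩⟩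

/-- **The `k`-subsets of `Z` meeting all three of `Y₁ Y₂ Y₃`**, by inclusion–exclusion on the three complement families. -/
theorem ncard_subsets_inter_nonempty_three_add_le (Z Y₁ Y₂ Y₃ : Set α) (hZ : Z.Finite) (k : ℕ) :
    {X : Set α | X ⊆ Z ∧ X.ncard = k ∧ (X ∩ Y₁).Nonempty ∧ (X ∩ Y₂).Nonempty ∧ (X ∩ Y₃).Nonempty}.ncard +
      (Z \ Y₁).ncard.choose k + (Z \ Y₂).ncard.choose k + (Z \ Y₃).ncard.choose k +
      (Z \ (Y₁ ∪ Y₂ ∪ Y₃)).ncard.choose k ≤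
      Z.ncard.choose k + (Z \ (Y₁ ∪ Y₂)).ncard.choose k + (Z \ (Y₁ ∪ Y₃)).ncard.choose k +
      (Z \ (Y₂ ∪ Y₃)).ncard.choose k := by
  classical
  set P := {X : Set α | X ⊆ Z ∧ X.ncard = k} with hP
  set A₁ := {X : Set α | X ⊆ Z \ Y₁ ∧ X.ncard = k} with hA₁
  set A₂ := {X : Set α | X ⊆ Z \ Y₂ ∧ X.ncard = k} with hA₂
  set A₃ := {X : Set α | X ⊆ Z \ Y₃ ∧ X.ncard = k} with hA₃
  have hPfin : P.Finite := hZ.finite_subsets.subset (fun X hX => hX.1)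
  have hA₁P : A₁ ⊆ P := fun X hX => ⟨hX.1.trans sdiff_subset, hX.2⟩
  have hA₂P : A₂ ⊆ P := fun X hX => ⟨hX.1.trans sdiff_subset, hX.2⟩
  have hA₃P : A₃ ⊆ P := fun X hX => ⟨hX.1.trans sdiff_subset, hX.2⟩
  have hA₁fin : A₁.Finite := hPfin.subset hA₁P
  have hA₂fin : A₂.Finite := hPfin.subset hA₂P
  have hA₃fin : A₃.Finite := hPfin.subset hA₃P
  -- the hit family avoids every `A_i`
  have hH : {X : Set α | X ⊆ Z ∧ X.ncard = k ∧ (X ∩ Y₁).Nonempty ∧ (X ∩ Y₂).Nonempty ∧ (X ∩ Y₃).Nonempty} ⊆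
      P \ (A₁ ∪ A₂ ∪ A₃) := by
    rintro X ⟨hXZ, hXk, hX1, hX2, hX3⟩
    refine ⟨⟨hXZ, hXk⟩, ?_⟩
    rintro ((h | h) | h)
    · obtain ⟨y, hyX, hyY⟩ := hX1
      exact (h.1 hyX).2 hyY
    · obtain ⟨y, hyX, hyY⟩ := hX2
      exact (h.1 hyX).2 hyY
    · obtain ⟨y, hyX, hyY⟩ := hX3
      exact (h.1 hyX).2 hyY
  -- the intersections
  have h12 : A₁ ∩ A₂ = {X : Set α | X ⊆ Z \ (Y₁ ∪ Y₂) ∧ X.ncard = k} := subsets_sdiff_inter_eq Z Y₁ Y₂ k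
  have h13 : A₁ ∩ A₃ = {X : Set α | X ⊆ Z \ (Y₁ ∪ Y₃) ∧ X.ncard = k} := subsets_sdiff_inter_eq Z Y₁ Y₃ k
  have h23 : A₂ ∩ A₃ = {X : Set α | X ⊆ Z \ (Y₂ ∪ Y₃) ∧ X.ncard = k} := subsets_sdiff_inter_eq Z Y₂ Y₃ k
  have h123 : A₁ ∩ A₂ ∩ A₃ = {X : Set α | X ⊆ Z \ (Y₁ ∪ Y₂ ∪ Y₃) ∧ X.ncard = k} := by
    rw [h12]; exact subsets_sdiff_inter_eq Z (Y₁ ∪ Y₂) Y₃ k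
  -- `(A₁ ∪ A₂) ∩ A₃ = (A₁ ∩ A₃) ∪ (A₂ ∩ A₃)` and `(A₁ ∩ A₃) ∩ (A₂ ∩ A₃) = A₁ ∩ A₂ ∩ A₃`
  have hdist : (A₁ ∪ A₂) ∩ A₃ = (A₁ ∩ A₃) ∪ (A₂ ∩ A₃) := Set.union_inter_distrib_right A₁ A₂ A₃
  have hii : (A₁ ∩ A₃) ∩ (A₂ ∩ A₃) = A₁ ∩ A₂ ∩ A₃ := by
    ext X; simp only [Set.mem_inter_iff]; tauto
  -- the cardinalities
  have c0 := Set.ncard_le_ncard hH hPfin.sdiff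
  have c1 := Set.ncard_sdiff_add_ncard_of_subset (Set.union_subset (Set.union_subset hA₁P hA₂P) hA₃P) hPfin
  have c2 := Set.ncard_union_add_ncard_inter (A₁ ∪ A₂) A₃ (hA₁fin.union hA₂fin) hA₃fin
  have c3 := Set.ncard_union_add_ncard_inter A₁ A₂ hA₁fin hA₂fin
  have c4 := Set.ncard_union_add_ncard_inter (A₁ ∩ A₃) (A₂ ∩ A₃) (hA₁fin.subset Set.inter_subset_left)
    (hA₂fin.subset Set.inter_subset_left)
  rw [hdist] at c2
  rw [hii] at c4
  have hPc : P.ncard = Z.ncard.choose k := ncard_subsets_ncard_eq Z hZ k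
  have hA₁c : A₁.ncard = (Z \ Y₁).ncard.choose k := ncard_subsets_ncard_eq (Z \ Y₁) hZ.sdiff k
  have hA₂c : A₂.ncard = (Z \ Y₂).ncard.choose k := ncard_subsets_ncard_eq (Z \ Y₂) hZ.sdiff k
  have hA₃c : A₃.ncard = (Z \ Y₃).ncard.choose k := ncard_subsets_ncard_eq (Z \ Y₃) hZ.sdiff k
  have h12c : (A₁ ∩ A₂).ncard = (Z \ (Y₁ ∪ Y₂)).ncard.choose k := by
    rw [h12]; exact ncard_subsets_ncard_eq (Z \ (Y₁ ∪ Y₂)) hZ.sdiff k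
  have h13c : (A₁ ∩ A₃).ncard = (Z \ (Y₁ ∪ Y₃)).ncard.choose k := by
    rw [h13]; exact ncard_subsets_ncard_eq (Z \ (Y₁ ∪ Y₃)) hZ.sdiff k
  have h23c : (A₂ ∩ A₃).ncard = (Z \ (Y₂ ∪ Y₃)).ncard.choose k := by
    rw [h23]; exact ncard_subsets_ncard_eq (Z \ (Y₂ ∪ Y₃)) hZ.sdiff k
  have h123c : (A₁ ∩ A₂ ∩ A₃).ncard = (Z \ (Y₁ ∪ Y₂ ∪ Y₃)).ncard.choose k := by
    rw [h123]; exact ncard_subsets_ncard_eq (Z \ (Y₁ ∪ Y₂ ∪ Y₃)) hZ.sdiff k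
  omega

/-- **The `k`-subsets of `Z` meeting at least two of `Y₁ Y₂ Y₃`**: the complement families `𝒫_k(Z ∖ (Y_i ∪ Y_j))` pairwise
meet in `𝒫_k(Z ∖ (Y₁ ∪ Y₂ ∪ Y₃))`. -/
theorem ncard_subsets_two_of_three_add_le (Z Y₁ Y₂ Y₃ : Set α) (hZ : Z.Finite) (k : ℕ) :
    {X : Set α | X ⊆ Z ∧ X.ncard = k ∧
      (((X ∩ Y₁).Nonempty ∧ (X ∩ Y₂).Nonempty) ∨ ((X ∩ Y₁).Nonempty ∧ (X ∩ Y₃).Nonempty) ∨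
        ((X ∩ Y₂).Nonempty ∧ (X ∩ Y₃).Nonempty))}.ncard +
      (Z \ (Y₁ ∪ Y₂)).ncard.choose k + (Z \ (Y₁ ∪ Y₃)).ncard.choose k + (Z \ (Y₂ ∪ Y₃)).ncard.choose k ≤
      Z.ncard.choose k + 2 * (Z \ (Y₁ ∪ Y₂ ∪ Y₃)).ncard.choose k := by
  classical
  set P := {X : Set α | X ⊆ Z ∧ X.ncard = k} with hP
  set B₁₂ := {X : Set α | X ⊆ Z \ (Y₁ ∪ Y₂) ∧ X.ncard = k} with hB₁₂
  set B₁₃ := {X : Set α | X ⊆ Z \ (Y₁ ∪ Y₃) ∧ X.ncard = k} with hB₁₃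
  set B₂₃ := {X : Set α | X ⊆ Z \ (Y₂ ∪ Y₃) ∧ X.ncard = k} with hB₂₃
  set C := {X : Set α | X ⊆ Z \ (Y₁ ∪ Y₂ ∪ Y₃) ∧ X.ncard = k} with hC
  have hPfin : P.Finite := hZ.finite_subsets.subset (fun X hX => hX.1)
  have hB₁₂P : B₁₂ ⊆ P := fun X hX => ⟨hX.1.trans sdiff_subset, hX.2⟩
  have hB₁₃P : B₁₃ ⊆ P := fun X hX => ⟨hX.1.trans sdiff_subset, hX.2⟩
  have hB₂₃P : B₂₃ ⊆ P := fun X hX => ⟨hX.1.trans sdiff_subset, hX.2⟩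
  have hB₁₂fin : B₁₂.Finite := hPfin.subset hB₁₂P
  have hB₁₃fin : B₁₃.Finite := hPfin.subset hB₁₃P
  have hB₂₃fin : B₂₃.Finite := hPfin.subset hB₂₃P
  -- a set inside `Z ∖ (Y_i ∪ Y_j)` misses `Y_i` and `Y_j`
  have hmiss : ∀ {X Y Y' : Set α}, X ⊆ Z \ (Y ∪ Y') → ¬ (X ∩ Y).Nonempty ∧ ¬ (X ∩ Y').Nonempty := by
    intro X Y Y' h
    refine ⟨?_, ?_⟩
    · rintro ⟨y, hyX, hyY⟩; exact (h hyX).2 (Or.inl hyY)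
    · rintro ⟨y, hyX, hyY⟩; exact (h hyX).2 (Or.inr hyY)
  have hH : {X : Set α | X ⊆ Z ∧ X.ncard = k ∧
      (((X ∩ Y₁).Nonempty ∧ (X ∩ Y₂).Nonempty) ∨ ((X ∩ Y₁).Nonempty ∧ (X ∩ Y₃).Nonempty) ∨
        ((X ∩ Y₂).Nonempty ∧ (X ∩ Y₃).Nonempty))} ⊆ P \ (B₁₂ ∪ B₁₃ ∪ B₂₃) := by
    rintro X ⟨hXZ, hXk, hX⟩
    refine ⟨⟨hXZ, hXk⟩, ?_⟩
    rintro ((h | h) | h)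
    · have := hmiss h.1; tauto
    · have := hmiss h.1; tauto
    · have := hmiss h.1; tauto
  -- every intersection of two of the `B`'s is `C`
  have h1 : B₁₂ ∩ B₁₃ = C := by
    rw [hB₁₂, hB₁₃, subsets_sdiff_inter_eq, hC]
    have : Y₁ ∪ Y₂ ∪ (Y₁ ∪ Y₃) = Y₁ ∪ Y₂ ∪ Y₃ := by ext y; simp only [Set.mem_union]; tauto
    rw [this]
  have h2 : B₁₂ ∩ B₂₃ = C := by
    rw [hB₁₂, hB₂₃, subsets_sdiff_inter_eq, hC]
    have : Y₁ ∪ Y₂ ∪ (Y₂ ∪ Y₃) = Y₁ ∪ Y₂ ∪ Y₃ := by ext y; simp only [Set.mem_union]; tauto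
    rw [this]
  have h3 : B₁₃ ∩ B₂₃ = C := by
    rw [hB₁₃, hB₂₃, subsets_sdiff_inter_eq, hC]
    have : Y₁ ∪ Y₃ ∪ (Y₂ ∪ Y₃) = Y₁ ∪ Y₂ ∪ Y₃ := by ext y; simp only [Set.mem_union]; tauto
    rw [this]
  have hdist : (B₁₂ ∪ B₁₃) ∩ B₂₃ = (B₁₂ ∩ B₂₃) ∪ (B₁₃ ∩ B₂₃) := Set.union_inter_distrib_right B₁₂ B₁₃ B₂₃
  rw [h2, h3, Set.union_self] at hdist
  have c0 := Set.ncard_le_ncard hH hPfin.sdiff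
  have c1 := Set.ncard_sdiff_add_ncard_of_subset (Set.union_subset (Set.union_subset hB₁₂P hB₁₃P) hB₂₃P) hPfin
  have c2 := Set.ncard_union_add_ncard_inter (B₁₂ ∪ B₁₃) B₂₃ (hB₁₂fin.union hB₁₃fin) hB₂₃fin
  have c3 := Set.ncard_union_add_ncard_inter B₁₂ B₁₃ hB₁₂fin hB₁₃fin
  rw [hdist] at c2
  rw [h1] at c3
  have hPc : P.ncard = Z.ncard.choose k := ncard_subsets_ncard_eq Z hZ k
  have hB₁₂c : B₁₂.ncard = (Z \ (Y₁ ∪ Y₂)).ncard.choose k := ncard_subsets_ncard_eq (Z \ (Y₁ ∪ Y₂)) hZ.sdiff k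
  have hB₁₃c : B₁₃.ncard = (Z \ (Y₁ ∪ Y₃)).ncard.choose k := ncard_subsets_ncard_eq (Z \ (Y₁ ∪ Y₃)) hZ.sdiff k
  have hB₂₃c : B₂₃.ncard = (Z \ (Y₂ ∪ Y₃)).ncard.choose k := ncard_subsets_ncard_eq (Z \ (Y₂ ∪ Y₃)) hZ.sdiff k
  have hCc : C.ncard = (Z \ (Y₁ ∪ Y₂ ∪ Y₃)).ncard.choose k := ncard_subsets_ncard_eq (Z \ (Y₁ ∪ Y₂ ∪ Y₃)) hZ.sdiff k
  omega

end S2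

end PercRepro
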